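import Mathlib
import Literature.MathematicalPhysics.QuantumFieldTheory.Balaban1983to89.B13FamilySum
import Summits.QuantumFields.BalabanUV.Beta.MarkedLocalized347

/-!
# Beta / MarkedLocalizedBound347 — BINDER-OWNERS row D4, co-owner road P2′: the TREE-DECAY BOUND of the localized marked
# terms of [Balaban1988Convergent] (3.47) p. 278 — leaf R.3 Part B — from the termwise majorant of `MarkedLocalized347` and
# the anchored family-sum engine of the tree's `B13FamilySum` ((2.27)-extraction + (1.26)-type anchor bound), abstract form
# (β sub-cell, unit `b2b-balaban-beta-d4-p2`, generation 1; leaf R.3-B of `HOME/beta/skeletons/D4-b2b-balaban-beta-d4-p2.md`)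

HONEST FRAMING (page 1 of everything the β sub-cell writes): discharging `BetaPertH` makes Bałaban's UV stability
UNCONDITIONAL — a real constructive-QFT result; it is NOT the continuum limit and NOT the Clay problem.  HONEST DEPENDENCY
(cell reorg 2026-08-19, verbatim): «continuum YM on T⁴ ⇐ BetaPertH ∧ nine spine estimates (0/9 proved); BetaPertH ⇐ (D1) ∧
(D4) ∧ CAP+tail; G-an2-4 gates asym, D1 and NE2/3/4.»  THIS MODULE INSTANTIATES NO BINDER AND ASSERTS NOTHING ABOUT
BAŁABAN'S ACTIVITIES: real-analysis bookkeeping over finite families of footprints, every geometric input ((2.27)-type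
tree-length extraction for the covering family, (1.26)-type anchored sum, nonempty footprints) a displayed HYPOTHESIS,
proved from Mathlib and the UNMODIFIED modules `…B13FamilySum` (`prod_one_add_le_exp_sum`, `sum_inside_le_card_mul`) and
the co-owner's `MarkedLocalized347` (`norm_mloc_le_of_bound`) BY NAME.

ABSOLUTE RULE (cell charter, verbatim): "No internally-minted statement may enter as a cited fact. Every hypothesis is
either kernel-proved in this package or a verbatim quotation of a PUBLISHED theorem with page reference. The manuscript(s)
under audit are NOT citable for their own disputed steps — they are the thing under adjudication; programme-internal
(2001/route/tribunal) claims are never citable."  Nothing is cited as a fact here.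

## What is typed

[III] p. 278 (3.47): «This, after the proper resummation, yields the representation [the expectation value in (3.37)] =
Σ_{X∈𝐃_{k+1}, X∋b} 𝐄₀^{(k+1)}(Λ_{k+1}, X, b) … The terms of the sum above satisfy the bounds (2.42), with the constant B₀
replaced by O(p₀³(g_k))».  `MarkedLocalized347.markedExpect_eq_sum_mloc` typed the IDENTITY; here the BOUND of the
X-localized Mayer term `mloc_{Z₀}(X) = Σ_{F ⊆ Ys : fpZ₀ ∪ ⋃F = X} Π_{Y∈F}(e^{−Ẽ(Y)} − 1)`:
* `norm_mloc_le_decay` — given `‖Ẽ(Y)‖ ≤ ε·e^{−r₁ d(Y)}` for the touching footprints (the shape `B13Resummation.norm_locE_le`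
  delivers for the exponent of (3.45)), `ε ≤ 1`, a (2.27)-type extraction `dX + c ≤ (d₀ + c) + Σ_{Y∈F}(d(Y) + c)` for every
  family `F` with `fpZ₀ ∪ ⋃F = X` (printed (2.27) at scale k + 1 for the covering family {Z₀} ∪ F), nonempty footprints,
  and a (1.26)-type anchored bound `Σ_{Y ∋ q} e^{−(r₁ − r′)d(Y)} ≤ K₀` for the cubes `q` of `X`:
  **`‖mloc_{Z₀}(X)‖ ≤ e^{−r′(dX − d₀)} · exp(|X| · ε·e·e^{r′c}·K₀)`** for `0 ≤ r′ ≤ r₁`;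
* `norm_marked_term_le` — multiplying by the marked activity `‖w′(Z₀)‖ ≤ m·e^{−R d₀}` with `R ≥ r′`:
  `‖w′(Z₀)·mloc_{Z₀}(X)‖ ≤ m · e^{−r′ dX} · exp(|X|·εee^{r′c}K₀)` — with `|X| ≤ c₁(1 + dX)` (road P1's `VolBound`) this is
  `≤ m·e^{c₁εee^{r′c}K₀} · e^{−(r′ − c₁εee^{r′c}K₀)·dX}`: the (I.1.18)/(2.42)-SHAPED decay of the (3.47) terms per marked
  polymer, rate `r′ − c₁εe^{1+r′c}K₀` (positive for ε small: the convergence smallness of road P1's N1), constant LINEAR in the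
  insertion's sup `m` — i.e. the `h118` field of `RoadP2Chain.PolLeavesT118` up to the anchor sum over `Z₀ ∋ b` ((1.26) again).
* (v2, §3) `norm_sum_marked_le_decay` — the finite anchor sum over the marked polymers `Z₀ ∋ b` ((1.26)-type bound `≤ K₁` as a
  hypothesis): `‖Σ_{Z₀} w′(Z₀)·mloc_{Z₀}(X)‖ ≤ (m·K₁·e^{c₁η})·e^{−(r′ − c₁η)dX}` — LITERALLY the `h118` shape `Abud·e^{−κ d(X)}`.
NOT CLAIMED: the geometric hypotheses for Bałaban's domains (they are road P1's CONSTRUCTED torus leaves, by name, once the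
footprint catalogue is instantiated); anything of `BetaPertH`; NOT continuum, NOT Clay.
-/

namespace Summit.QuantumFields.BalabanUV.Beta.MarkedLocalizedBound347

open Finset
open Literature.MathematicalPhysics.QuantumFieldTheory.Balaban1983to89.B13FamilySum
open Summit.QuantumFields.BalabanUV.Beta.MarkedLocalized347

noncomputable section

variable {Cube : Type*} [DecidableEq Cube]

/-- For `0 ≤ x ≤ 1`: `x·e^x ≤ e·x`. -/
theorem mul_exp_le_e_mul {x : ℝ} (hx0 : 0 ≤ x) (hx1 : x ≤ 1) : x * Real.exp x ≤ Real.exp 1 * x := by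
  rw [mul_comm (Real.exp 1)]
  exact mul_le_mul_of_nonneg_left (Real.exp_le_exp.2 hx1) hx0

/-- **R.3-B — TREE DECAY OF THE LOCALIZED MARKED MAYER TERM.**  See the module docstring for the reading of each hypothesis. -/
theorem norm_mloc_le_decay (Ys : Finset (Finset Cube)) (t : Finset Cube → ℂ) (F₀ X : Finset Cube)
    (dY : Finset Cube → ℝ) {ε r₁ r' c d₀ dX K₀ : ℝ}
    (hε0 : 0 ≤ ε) (hε1 : ε ≤ 1) (hr' : 0 ≤ r') (hr'r : r' ≤ r₁)
    (hd : ∀ Y ∈ Ys, 0 ≤ dY Y)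
    (ht : ∀ Y ∈ Ys, ‖t Y‖ ≤ ε * Real.exp (-(r₁ * dY Y)))
    (hne : ∀ Y ∈ Ys, Y.Nonempty)
    (h227 : ∀ F ∈ Ys.powerset, F₀ ∪ F.biUnion id = X → dX + c ≤ (d₀ + c) + ∑ Y ∈ F, (dY Y + c))
    (hanch : ∀ q ∈ X, ∑ Y ∈ Ys.filter (fun Y => q ∈ Y), Real.exp (-((r₁ - r') * dY Y)) ≤ K₀) :
    ‖mloc Ys t F₀ X‖ ≤
      Real.exp (-(r' * (dX - d₀))) * Real.exp ((X.card : ℝ) * (ε * Real.exp 1 * Real.exp (r' * c) * K₀)) := by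
  classical
  -- the decay-free weight β'(Y) := ε e e^{r'c} e^{-(r₁ - r') d Y}
  set β' : Finset Cube → ℝ := fun Y => ε * Real.exp 1 * Real.exp (r' * c) * Real.exp (-((r₁ - r') * dY Y))
    with hβ'
  have hβ'0 : ∀ Y, 0 ≤ β' Y := fun Y => by simp only [hβ']; positivity
  -- step 1: termwise majorant with β(Y) = ε e^{-r₁ d Y}
  have h1 := norm_mloc_le_of_bound Ys t F₀ X (β := fun Y => ε * Real.exp (-(r₁ * dY Y))) ht
  refine h1.trans ?_
  -- step 2: per covering family, extract e^{-r'(dX - d₀)} and bound the rest by Π β'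
  have hfam : ∀ F ∈ Ys.powerset.filter (fun F => F₀ ∪ F.biUnion id = X),
      ∏ Y ∈ F, (ε * Real.exp (-(r₁ * dY Y)) * Real.exp (ε * Real.exp (-(r₁ * dY Y)))) ≤
        Real.exp (-(r' * (dX - d₀))) * ∏ Y ∈ F, β' Y := by
    intro F hF
    obtain ⟨hFp, hFX⟩ := mem_filter.1 hF
    have hFY : F ⊆ Ys := mem_powerset.1 hFp
    -- each factor: β e^{β} ≤ ε e · e^{-r₁ d} = e^{-r'(d + c)} · β'
    have hfac : ∀ Y ∈ F, ε * Real.exp (-(r₁ * dY Y)) * Real.exp (ε * Real.exp (-(r₁ * dY Y))) ≤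
        Real.exp (-(r' * (dY Y + c))) * β' Y := by
      intro Y hY
      have hdY := hd Y (hFY hY)
      have hx1 : ε * Real.exp (-(r₁ * dY Y)) ≤ 1 := by
        calc ε * Real.exp (-(r₁ * dY Y)) ≤ 1 * 1 := by
              apply mul_le_mul hε1 _ (Real.exp_pos _).le zero_le_one
              rw [Real.exp_le_one_iff]; nlinarith
          _ = 1 := one_mul 1
      have hx0 : 0 ≤ ε * Real.exp (-(r₁ * dY Y)) := by positivity
      calc ε * Real.exp (-(r₁ * dY Y)) * Real.exp (ε * Real.exp (-(r₁ * dY Y)))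
          ≤ Real.exp 1 * (ε * Real.exp (-(r₁ * dY Y))) := mul_exp_le_e_mul hx0 hx1
        _ = Real.exp (-(r' * (dY Y + c))) * β' Y := by
            simp only [hβ']
            have : Real.exp (-(r₁ * dY Y)) =
                Real.exp (-(r' * (dY Y + c))) * (Real.exp (r' * c) * Real.exp (-((r₁ - r') * dY Y))) := by
              rw [← Real.exp_add, ← Real.exp_add]; congr 1; ring
            rw [this]; ring
    calc ∏ Y ∈ F, (ε * Real.exp (-(r₁ * dY Y)) * Real.exp (ε * Real.exp (-(r₁ * dY Y))))
        ≤ ∏ Y ∈ F, (Real.exp (-(r' * (dY Y + c))) * β' Y) :=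
          prod_le_prod (fun Y _ => by positivity) hfac
      _ = Real.exp (-(r' * ∑ Y ∈ F, (dY Y + c))) * ∏ Y ∈ F, β' Y := by
          rw [prod_mul_distrib, ← Real.exp_sum]; congr 1; congr 1
          rw [mul_sum, ← sum_neg_distrib]
      _ ≤ Real.exp (-(r' * (dX - d₀))) * ∏ Y ∈ F, β' Y := by
          apply mul_le_mul_of_nonneg_right _ (prod_nonneg fun Y _ => hβ'0 Y)
          apply Real.exp_le_exp.2
          have h := h227 F hFp hFX
          nlinarith
  -- step 3: sum over covering families ≤ e^{...} Σ_{F ⊆ inside} Π β' = e^{...} Π (1 + β') ≤ e^{...} exp(Σ β')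
  have hsub : Ys.powerset.filter (fun F => F₀ ∪ F.biUnion id = X) ⊆ (inside Ys id X).powerset := by
    intro F hF
    obtain ⟨hFp, hFX⟩ := mem_filter.1 hF
    rw [mem_powerset]
    intro Y hY
    refine mem_inside.2 ⟨mem_powerset.1 hFp hY, ?_⟩
    rw [← hFX]
    exact (Finset.subset_biUnion_of_mem id hY).trans subset_union_right
  calc ∑ F ∈ Ys.powerset.filter (fun F => F₀ ∪ F.biUnion id = X),
        ∏ Y ∈ F, (ε * Real.exp (-(r₁ * dY Y)) * Real.exp (ε * Real.exp (-(r₁ * dY Y))))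
      ≤ ∑ F ∈ Ys.powerset.filter (fun F => F₀ ∪ F.biUnion id = X),
          Real.exp (-(r' * (dX - d₀))) * ∏ Y ∈ F, β' Y := sum_le_sum hfam
    _ = Real.exp (-(r' * (dX - d₀))) *
          ∑ F ∈ Ys.powerset.filter (fun F => F₀ ∪ F.biUnion id = X), ∏ Y ∈ F, β' Y := by rw [mul_sum]
    _ ≤ Real.exp (-(r' * (dX - d₀))) * ∑ F ∈ (inside Ys id X).powerset, ∏ Y ∈ F, β' Y := by
          apply mul_le_mul_of_nonneg_left _ (Real.exp_pos _).le
          exact sum_le_sum_of_subset_of_nonneg hsub fun F _ _ => prod_nonneg fun Y _ => hβ'0 Y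
    _ = Real.exp (-(r' * (dX - d₀))) * ∏ Y ∈ inside Ys id X, (1 + β' Y) := by rw [Finset.prod_one_add]
    _ ≤ Real.exp (-(r' * (dX - d₀))) * Real.exp (∑ Y ∈ inside Ys id X, β' Y) := by
          apply mul_le_mul_of_nonneg_left _ (Real.exp_pos _).le
          exact prod_one_add_le_exp_sum _ β' fun Y _ => hβ'0 Y
    _ ≤ Real.exp (-(r' * (dX - d₀))) * Real.exp ((X.card : ℝ) * (ε * Real.exp 1 * Real.exp (r' * c) * K₀)) := by
          apply mul_le_mul_of_nonneg_left _ (Real.exp_pos _).le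
          apply Real.exp_le_exp.2
          have hanch' : ∀ q ∈ X, ∑ Y ∈ Ys.filter (fun Y => q ∈ id Y), β' Y ≤
              ε * Real.exp 1 * Real.exp (r' * c) * K₀ := by
            intro q hq
            simp only [hβ', id]
            rw [← mul_sum]
            exact mul_le_mul_of_nonneg_left (hanch q hq) (by positivity)
          exact sum_inside_le_card_mul Ys id X β' _ (fun Y _ => hβ'0 Y) (fun Y hY => hne Y hY) hanch'

/-- **The marked term per marked polymer**: with `‖w′(Z₀)‖ ≤ m·e^{−R d₀}`, `R ≥ r′`, `d₀ ≥ 0`: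
`‖w′(Z₀)·mloc_{Z₀}(X)‖ ≤ m · e^{−r′dX} · exp(|X|·εee^{r′c}K₀)`. -/
theorem norm_marked_term_le (Ys : Finset (Finset Cube)) (t : Finset Cube → ℂ) (F₀ X : Finset Cube)
    (dY : Finset Cube → ℝ) {ε r₁ r' c d₀ dX K₀ R m : ℝ} {w₀ : ℂ}
    (hε0 : 0 ≤ ε) (hε1 : ε ≤ 1) (hr' : 0 ≤ r') (hr'r : r' ≤ r₁) (hd₀ : 0 ≤ d₀)
    (hR : r' ≤ R) (hm : 0 ≤ m) (hw₀ : ‖w₀‖ ≤ m * Real.exp (-(R * d₀)))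
    (hd : ∀ Y ∈ Ys, 0 ≤ dY Y)
    (ht : ∀ Y ∈ Ys, ‖t Y‖ ≤ ε * Real.exp (-(r₁ * dY Y)))
    (hne : ∀ Y ∈ Ys, Y.Nonempty)
    (h227 : ∀ F ∈ Ys.powerset, F₀ ∪ F.biUnion id = X → dX + c ≤ (d₀ + c) + ∑ Y ∈ F, (dY Y + c))
    (hanch : ∀ q ∈ X, ∑ Y ∈ Ys.filter (fun Y => q ∈ Y), Real.exp (-((r₁ - r') * dY Y)) ≤ K₀) :
    ‖w₀ * mloc Ys t F₀ X‖ ≤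
      m * Real.exp (-(r' * dX)) * Real.exp ((X.card : ℝ) * (ε * Real.exp 1 * Real.exp (r' * c) * K₀)) := by
  have h := norm_mloc_le_decay Ys t F₀ X dY hε0 hε1 hr' hr'r hd ht hne h227 hanch
  rw [norm_mul]
  have hE : 0 ≤ Real.exp (-(r' * (dX - d₀))) *
      Real.exp ((X.card : ℝ) * (ε * Real.exp 1 * Real.exp (r' * c) * K₀)) := by positivity
  calc ‖w₀‖ * ‖mloc Ys t F₀ X‖
      ≤ (m * Real.exp (-(R * d₀))) * (Real.exp (-(r' * (dX - d₀))) *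
          Real.exp ((X.card : ℝ) * (ε * Real.exp 1 * Real.exp (r' * c) * K₀))) :=
        mul_le_mul hw₀ h (norm_nonneg _) (by positivity)
    _ = m * (Real.exp (-(R * d₀)) * Real.exp (-(r' * (dX - d₀)))) *
          Real.exp ((X.card : ℝ) * (ε * Real.exp 1 * Real.exp (r' * c) * K₀)) := by ring
    _ ≤ m * Real.exp (-(r' * dX)) *
          Real.exp ((X.card : ℝ) * (ε * Real.exp 1 * Real.exp (r' * c) * K₀)) := by
        apply mul_le_mul_of_nonneg_right _ (Real.exp_pos _).le
        apply mul_le_mul_of_nonneg_left _ hm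
        rw [← Real.exp_add]
        apply Real.exp_le_exp.2
        nlinarith

/-- **With the volume bound `|X| ≤ c₁(1 + dX)`** (road P1's `VolBound` for localization domains): the (I.1.18)-SHAPED
decay `‖w′(Z₀)·mloc_{Z₀}(X)‖ ≤ m·e^{c₁η}·e^{−(r′ − c₁η)·dX}`, `η := ε·e·e^{r′c}·K₀` — constant LINEAR in the insertion's
sup `m`, rate `r′ − c₁η`. -/
theorem norm_marked_term_le_decay (Ys : Finset (Finset Cube)) (t : Finset Cube → ℂ) (F₀ X : Finset Cube)
    (dY : Finset Cube → ℝ) {ε r₁ r' c d₀ dX K₀ R m c₁ : ℝ} {w₀ : ℂ}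
    (hε0 : 0 ≤ ε) (hε1 : ε ≤ 1) (hr' : 0 ≤ r') (hr'r : r' ≤ r₁) (hd₀ : 0 ≤ d₀)
    (hR : r' ≤ R) (hm : 0 ≤ m) (hw₀ : ‖w₀‖ ≤ m * Real.exp (-(R * d₀)))
    (hd : ∀ Y ∈ Ys, 0 ≤ dY Y)
    (ht : ∀ Y ∈ Ys, ‖t Y‖ ≤ ε * Real.exp (-(r₁ * dY Y)))
    (hne : ∀ Y ∈ Ys, Y.Nonempty)
    (h227 : ∀ F ∈ Ys.powerset, F₀ ∪ F.biUnion id = X → dX + c ≤ (d₀ + c) + ∑ Y ∈ F, (dY Y + c))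
    (hanch : ∀ q ∈ X, ∑ Y ∈ Ys.filter (fun Y => q ∈ Y), Real.exp (-((r₁ - r') * dY Y)) ≤ K₀)
    (hK₀ : 0 ≤ K₀) (hvolX : (X.card : ℝ) ≤ c₁ * (1 + dX)) :
    ‖w₀ * mloc Ys t F₀ X‖ ≤
      m * Real.exp (c₁ * (ε * Real.exp 1 * Real.exp (r' * c) * K₀)) *
        Real.exp (-((r' - c₁ * (ε * Real.exp 1 * Real.exp (r' * c) * K₀)) * dX)) := by
  set η : ℝ := ε * Real.exp 1 * Real.exp (r' * c) * K₀ with hη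
  have hη0 : 0 ≤ η := by rw [hη]; positivity
  have h := norm_marked_term_le Ys t F₀ X dY hε0 hε1 hr' hr'r hd₀ hR hm hw₀ hd ht hne h227 hanch
  refine h.trans ?_
  have hcard : (X.card : ℝ) * η ≤ c₁ * (1 + dX) * η := mul_le_mul_of_nonneg_right hvolX hη0
  calc m * Real.exp (-(r' * dX)) * Real.exp ((X.card : ℝ) * η)
      ≤ m * Real.exp (-(r' * dX)) * Real.exp (c₁ * (1 + dX) * η) := by
        apply mul_le_mul_of_nonneg_left (Real.exp_le_exp.2 hcard) (by positivity)
    _ = m * Real.exp (-(r' * dX) + c₁ * (1 + dX) * η) := by rw [mul_assoc, ← Real.exp_add]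
    _ = m * Real.exp (c₁ * η + -((r' - c₁ * η) * dX)) := by congr 2; ring
    _ = m * Real.exp (c₁ * η) * Real.exp (-((r' - c₁ * η) * dX)) := by rw [Real.exp_add, mul_assoc]

/-! ## §3 The anchor sum over the marked polymers `Z₀ ∋ b` — the literal `h118` shape of (3.47)'s `𝐄₀^{(k+1)}(Λ, X, b)`
(appended v2; §1–§2 above byte-identical to v1 p207791) -/

/-- **R.3-B PACKAGED AS `RoadP2Chain.PolLeavesT118.h118`**: summing `norm_marked_term_le_decay` over the finite set `Mk` of
marked polymers (those containing the bond `b` with footprint inside `X`; the touching catalogue `Ys Z₀`, its exponents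
`t Z₀`, the footprint `fp Z₀` and the tree length `dZ Z₀` depend on the marked polymer), with marked activities
`‖w′(Z₀)‖ ≤ m·e^{−R d(Z₀)}`, `R ≥ r′`, and a (1.26)-type anchored sum over the polymers containing `b`,
`Σ_{Z₀∈Mk} e^{−(R − r′)d(Z₀)} ≤ K₁`:
`‖Σ_{Z₀∈Mk} w′(Z₀)·mloc_{Z₀}(X)‖ ≤ (m·K₁·e^{c₁η}) · e^{−(r′ − c₁η)·dX}`, `η = ε·e·e^{r′c}·K₀` — the printed «terms of the sum
above satisfy the bounds (2.42)» in the (I.1.18) shape `‖𝐄(X)‖ ≤ Abud·e^{−κ d(X)}` with activity `Abud = m·K₁·e^{c₁η}` LINEAR in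
the insertion sup `m` and rate `κ = r′ − c₁η`; every geometric input a displayed hypothesis, as in §1. -/
theorem norm_sum_marked_le_decay {ι : Type*} (Mk : Finset ι) (Ys : ι → Finset (Finset Cube))
    (t : ι → Finset Cube → ℂ) (fp : ι → Finset Cube) (dZ : ι → ℝ) (w' : ι → ℂ) (X : Finset Cube)
    (dY : Finset Cube → ℝ) {ε r₁ r' c dX K₀ R m c₁ K₁ : ℝ}
    (hε0 : 0 ≤ ε) (hε1 : ε ≤ 1) (hr' : 0 ≤ r') (hr'r : r' ≤ r₁) (hm : 0 ≤ m)
    (hdZ : ∀ Z₀ ∈ Mk, 0 ≤ dZ Z₀)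
    (hw : ∀ Z₀ ∈ Mk, ‖w' Z₀‖ ≤ m * Real.exp (-(R * dZ Z₀)))
    (hd : ∀ Z₀ ∈ Mk, ∀ Y ∈ Ys Z₀, 0 ≤ dY Y)
    (ht : ∀ Z₀ ∈ Mk, ∀ Y ∈ Ys Z₀, ‖t Z₀ Y‖ ≤ ε * Real.exp (-(r₁ * dY Y)))
    (hne : ∀ Z₀ ∈ Mk, ∀ Y ∈ Ys Z₀, Y.Nonempty)
    (h227 : ∀ Z₀ ∈ Mk, ∀ F ∈ (Ys Z₀).powerset, fp Z₀ ∪ F.biUnion id = X →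
      dX + c ≤ (dZ Z₀ + c) + ∑ Y ∈ F, (dY Y + c))
    (hanch : ∀ Z₀ ∈ Mk, ∀ q ∈ X,
      ∑ Y ∈ (Ys Z₀).filter (fun Y => q ∈ Y), Real.exp (-((r₁ - r') * dY Y)) ≤ K₀)
    (hK₀ : 0 ≤ K₀) (hvolX : (X.card : ℝ) ≤ c₁ * (1 + dX))
    (hanchZ : ∑ Z₀ ∈ Mk, Real.exp (-((R - r') * dZ Z₀)) ≤ K₁) :
    ‖∑ Z₀ ∈ Mk, w' Z₀ * mloc (Ys Z₀) (t Z₀) (fp Z₀) X‖ ≤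
      m * K₁ * Real.exp (c₁ * (ε * Real.exp 1 * Real.exp (r' * c) * K₀)) *
        Real.exp (-((r' - c₁ * (ε * Real.exp 1 * Real.exp (r' * c) * K₀)) * dX)) := by
  set η : ℝ := ε * Real.exp 1 * Real.exp (r' * c) * K₀ with hη
  -- each term: split the activity as (m·e^{−(R−r′)d₀})·e^{−r′d₀} and apply the decay corollary with R := r′
  have hterm : ∀ Z₀ ∈ Mk, ‖w' Z₀ * mloc (Ys Z₀) (t Z₀) (fp Z₀) X‖ ≤
      m * Real.exp (-((R - r') * dZ Z₀)) * Real.exp (c₁ * η) * Real.exp (-((r' - c₁ * η) * dX)) := by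
    intro Z₀ hZ
    have hm' : 0 ≤ m * Real.exp (-((R - r') * dZ Z₀)) := by positivity
    have hw' : ‖w' Z₀‖ ≤ m * Real.exp (-((R - r') * dZ Z₀)) * Real.exp (-(r' * dZ Z₀)) := by
      refine (hw Z₀ hZ).trans (le_of_eq ?_)
      rw [mul_assoc, ← Real.exp_add]; congr 1; congr 1; ring
    exact norm_marked_term_le_decay (Ys Z₀) (t Z₀) (fp Z₀) X dY hε0 hε1 hr' hr'r (hdZ Z₀ hZ) le_rfl hm' hw'
      (hd Z₀ hZ) (ht Z₀ hZ) (hne Z₀ hZ) (h227 Z₀ hZ) (hanch Z₀ hZ) hK₀ hvolX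
  calc ‖∑ Z₀ ∈ Mk, w' Z₀ * mloc (Ys Z₀) (t Z₀) (fp Z₀) X‖
      ≤ ∑ Z₀ ∈ Mk, ‖w' Z₀ * mloc (Ys Z₀) (t Z₀) (fp Z₀) X‖ := norm_sum_le _ _
    _ ≤ ∑ Z₀ ∈ Mk, m * Real.exp (-((R - r') * dZ Z₀)) * Real.exp (c₁ * η) *
          Real.exp (-((r' - c₁ * η) * dX)) := sum_le_sum hterm
    _ = m * (∑ Z₀ ∈ Mk, Real.exp (-((R - r') * dZ Z₀))) * Real.exp (c₁ * η) *
          Real.exp (-((r' - c₁ * η) * dX)) := by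
        rw [mul_sum, sum_mul, sum_mul]
    _ ≤ m * K₁ * Real.exp (c₁ * η) * Real.exp (-((r' - c₁ * η) * dX)) := by gcongr

end

end Summit.QuantumFields.BalabanUV.Beta.MarkedLocalizedBound347
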